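import Mathlib
import Summits.Ventures.PercRepro2.LocRows
import Summits.Ventures.PercRepro2.SwRow
import Summits.Ventures.PercRepro2.SwOut
import Summits.Ventures.PercRepro2.SwAllRow
import Summits.Ventures.PercRepro2.SwOutAll
import Summits.Ventures.PercRepro2.SwOutArmFlip
import Summits.Ventures.PercRepro2.SwOutArmThm
import Summits.Ventures.PercRepro2.SwOutCoreDefs
import Summits.Ventures.PercRepro2.SwOutCoreHull
import Summits.Ventures.PercRepro2.SwOutShadowDefs
import Summits.Ventures.PercRepro2.SwOutCoreShadowDefs

/-!
# The shadow base of a one-sided point of a core cube (blind cell PercRepro2, night-4 g13,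
2026-08-26; proofs/NIGHT4-G12.md §2 (2.2), proofs/NIGHT4-G13.md §4 (S1))

**`CoreBase.shadowBase`**: for a core base `ζ` and a cube point `ω₀` at which `u` is one-sided red,
`shadowOf ζ` (the base with the edges from `u` into the dropped arms turned blue) is a `ShadowBase`
on the arms `sX` (the coarse arm of `u`) and the far arms, with the decoration `sZ` (the dropped
arms) glued to `sX` — every field from the fields of the core base (`SwOutCoreShadowDefs`).
Hence the shadow cube of `ω₀` satisfies the rigid inequality (`card_shadowCube_le`); pairing it
with the points of the core cube is the partition of NIGHT4-G13.md §4.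
-/

namespace Summit.Ventures.PercRepro2

namespace LocRows

open Hull

variable {V : Type*} {E : Type*}

open scoped Classical

variable {ends : E → Sym2 V}

section ShadowBase

variable {ι : Type*} {A : ι → Set V} {pure : ι → Prop} {ζ : Config E} {h u : V} {H : Set V}
  (hb : CoreBase ends ζ h u H A pure) {ω₀ : Config ι}
  (huR : uRed ends A u pure ω₀) (huB : ¬ uRed ends A u pure (flipAll ω₀))
include hb huR huB

/-- **The shadow base of a one-sided point of a core cube is a shadow base.** -/
theorem CoreBase.shadowBase :
    ShadowBase ends (shadowOf ends u A ω₀ ζ) h (sZ ends u A ω₀) (sB ends u A ω₀) none where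
  h_notMem_B := by
    rintro (_ | ⟨i, hi⟩) hh
    · simp only [sB] at hh
      rcases mem_sX_iff.1 hh with hh | ⟨i, _, _, hh⟩
      · exact hb.hne hh
      · exact hb.h_notMem_arm i hh
    · exact hb.h_notMem_arm i hh
  h_notMem_Z := by
    rintro ⟨i, _, _, hh⟩
    exact hb.h_notMem_arm i hh
  B_disj := by
    rintro (_ | ⟨i, hi⟩) (_ | ⟨j, hj⟩) hne x hx hx'
    · exact hne rfl
    · simp only [sB] at hx hx'
      rcases mem_sX_iff.1 hx with rfl | ⟨i', hi', _, hx⟩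
      · exact hb.u_notMem_arm j hx'
      · have : i' = j := by
          by_contra hne'
          exact hb.arm_disj i' j hne' x hx hx'
        exact hj (this ▸ hi')
    · simp only [sB] at hx hx'
      rcases mem_sX_iff.1 hx' with rfl | ⟨j', hj', _, hx'⟩
      · exact hb.u_notMem_arm i hx
      · have : i = j' := by
          by_contra hne'
          exact hb.arm_disj i j' hne' x hx hx'
        exact hi (this ▸ hj')
    · simp only [sB] at hx hx'
      have hij : i ≠ j := fun h' => hne (by subst h'; rfl)
      exact hb.arm_disj i j hij x hx hx'
  B_disj_Z := by
    rintro (_ | ⟨i, hi⟩) x hx ⟨j, hj, hωj, hxj⟩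
    · simp only [sB] at hx
      rcases mem_sX_iff.1 hx with rfl | ⟨i', _, hωi', hx⟩
      · exact hb.u_notMem_arm j hxj
      · have : i' = j := by
          by_contra hne'
          exact hb.arm_disj i' j hne' x hx hxj
        subst this
        rw [hωi'] at hωj; exact absurd hωj (by decide)
    · simp only [sB] at hx
      have : i = j := by
        by_contra hne'
        exact hb.arm_disj i j hne' x hx hxj
      exact hi (this ▸ hj)
  B_nonempty := by
    rintro (_ | ⟨i, hi⟩)
    · exact ⟨u, mem_sX_iff.2 (Or.inl rfl)⟩
    · exact hb.arm_nonempty i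
  bdry_blue := by
    intro e x y hxy hxR hyR
    rw [hb.shadow_region_eq] at hxR hyR
    have hyu : y ≠ u := fun h' => hyR (h' ▸ hb.u_mem)
    have hnot : ¬ ∃ z ∈ sZ ends u A ω₀, ends e = s(u, z) := by
      rintro ⟨z, hz, hez⟩
      rw [hxy, Sym2.eq_iff] at hez
      rcases hez with ⟨_, h2⟩ | ⟨_, h2⟩
      · obtain ⟨i, _, _, hzi⟩ := hz
        exact hyR (h2 ▸ (hb.arm_sub i z hzi).1)
      · exact hyu h2
    rw [shadowOf_apply_of_not hnot]
    exact hb.bdry_blue e x y hxy hxR hyR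
  no_cross := by
    rintro (_ | ⟨i, hi⟩) (_ | ⟨j, hj⟩) hne e x y hxy hx hy
    · exact hne rfl
    · simp only [sB] at hx hy
      have hxu : x = u := hb.eq_u_of_edge_sX hxy hx hy (fun h' => hj h'.1)
      subst hxu
      exact hj ⟨e, y, hxy, hy⟩
    · simp only [sB] at hx hy
      have hyu : y = u := hb.eq_u_of_edge_sX (ends_swap hxy) hy hx (fun h' => hi h'.1)
      subst hyu
      exact hi ⟨e, x, ends_swap hxy, hx⟩
    · simp only [sB] at hx hy
      have hij : i ≠ j := fun h' => hne (by subst h'; rfl)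
      exact hb.no_cross i j hij e x y hxy hx hy
  no_BZ := by
    rintro (_ | ⟨i, hi⟩) hne e x y hxy hx ⟨j, hj, _, hyj⟩
    · exact hne rfl
    · simp only [sB] at hx
      have hij : i ≠ j := fun h' => hi (h' ▸ hj)
      exact hb.no_cross i j hij e x y hxy hx hyj
  no_hZ := by
    rintro e y hey ⟨j, hj, hωj, hyj⟩
    exact hb.pure_no_h j (CoreBase.pure_of_mem_sZ huB hj hωj) e y hey hyj
  kZ_blue := by
    intro e x y hxy hx hy
    simp only [sB] at hx
    obtain ⟨j, hj, hωj, hyj⟩ := hy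
    have hxu : x = u := hb.eq_u_of_edge_sX hxy hx hyj (fun h' => by
      rw [h'.2] at hωj; exact absurd hωj (by decide))
    subst hxu
    rw [shadowOf_apply_of_mem_sZ ⟨j, hj, hωj, hyj⟩ hxy, hb.u_red e y hxy]
    rfl
  h_edges := by
    intro e x hxe
    obtain ⟨i, hxi⟩ := hb.h_edges e x hxe
    by_cases hadj : uAdjC ends u A i
    · cases hω : ω₀ i with
      | true => exact ⟨none, by simp only [sB]; exact mem_sX_iff.2 (Or.inr ⟨i, hadj, hω, hxi⟩)⟩
      | false =>
        exfalso
        exact hb.pure_no_h i (CoreBase.pure_of_mem_sZ huB hadj hω) e x hxe hxi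
    · exact ⟨some ⟨i, hadj⟩, hxi⟩
  h_red := by
    intro e x hxe
    rw [shadowOf_apply_of_notMem_u]
    · exact hb.h_red e x hxe
    · rw [hxe, Sym2.mem_iff]
      rintro (h' | h')
      · exact hb.hne h'.symm
      · exact hb.no_hu e (by rw [hxe, h'])
  B_conn := by
    rintro (_ | ⟨i, hi⟩) x hx
    · -- the coarse arm of `u`
      simp only [sB] at hx ⊢
      have hZ : ∀ z ∈ sZ ends u A ω₀, z ∉ sX ends u A ω₀ ∪ {h} := by
        rintro z ⟨j, _, hωj, hzj⟩ (hz | hz)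
        · rcases mem_sX_iff.1 hz with rfl | ⟨i', _, hωi', hzi'⟩
          · exact hb.u_notMem_arm j hzj
          · have : i' = j := by
              by_contra hne'
              exact hb.arm_disj i' j hne' z hzi' hzj
            subst this
            rw [hωi'] at hωj; exact absurd hωj (by decide)
        · rw [Set.mem_singleton_iff] at hz
          exact hb.h_notMem_arm j (hz ▸ hzj)
      rw [insideConfig_shadowOf hZ]
      -- `u` is inside-connected to `h` through a red h-arm adjacent to `u`
      obtain ⟨i₀, hi₀, hp₀, e₀, x₀, hux₀, hx₀⟩ := huR
      have hsub₀ : A i₀ ∪ {h} ⊆ sX ends u A ω₀ ∪ {h} := by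
        rintro y (hy | hy)
        · exact Or.inl (mem_sX_iff.2 (Or.inr ⟨i₀, ⟨e₀, x₀, hux₀, hx₀⟩, hi₀, hy⟩))
        · exact Or.inr hy
      have hx₀c : x₀ ∈ cluster ends (insideConfig ends (sX ends u A ω₀ ∪ {h}) ζ) h :=
        cluster_mono (insideConfig_mono_set hsub₀ ζ) h (hb.harm_conn i₀ hp₀ x₀ hx₀)
      have huc : u ∈ cluster ends (insideConfig ends (sX ends u A ω₀ ∪ {h}) ζ) h := by
        refine mem_cluster_of_edge hx₀c ?_ (ends_swap hux₀)
        exact insideConfig_eq_true_iff.2 ⟨hb.u_red e₀ x₀ hux₀, x₀, Or.inl (mem_sX_iff.2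
          (Or.inr ⟨i₀, ⟨e₀, x₀, hux₀, hx₀⟩, hi₀, hx₀⟩)), u, Or.inl (mem_sX_iff.2 (Or.inl rfl)),
          ends_swap hux₀⟩
      rcases mem_sX_iff.1 hx with rfl | ⟨i, hi, hωi, hxi⟩
      · exact huc
      · have hsub : A i ∪ {h} ⊆ sX ends u A ω₀ ∪ {h} := by
          rintro y (hy | hy)
          · exact Or.inl (mem_sX_iff.2 (Or.inr ⟨i, hi, hωi, hy⟩))
          · exact Or.inr hy
        by_cases hp : pure i
        · have hsub' : A i ∪ {u} ⊆ sX ends u A ω₀ ∪ {h} := by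
            rintro y (hy | hy)
            · exact Or.inl (mem_sX_iff.2 (Or.inr ⟨i, hi, hωi, hy⟩))
            · rw [Set.mem_singleton_iff] at hy
              exact Or.inl (mem_sX_iff.2 (Or.inl hy))
          have := cluster_mono (insideConfig_mono_set hsub' ζ) u (hb.pure_conn i hp x hxi)
          exact conn_trans huc this
        · exact cluster_mono (insideConfig_mono_set hsub ζ) h (hb.harm_conn i hp x hxi)
    · -- a far arm: an h-arm, inside-connected in the base
      simp only [sB] at hx ⊢
      have hZ : ∀ z ∈ sZ ends u A ω₀, z ∉ A i ∪ {h} := by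
        rintro z ⟨j, hj, _, hzj⟩ (hz | hz)
        · have : i = j := by
            by_contra hne'
            exact hb.arm_disj i j hne' z hz hzj
          exact hi (this ▸ hj)
        · rw [Set.mem_singleton_iff] at hz
          exact hb.h_notMem_arm j (hz ▸ hzj)
      rw [insideConfig_shadowOf hZ]
      exact hb.harm_conn i (hb.not_pure_of_not_uAdjC hi) x hx

end ShadowBase

end LocRows

end Summit.Ventures.PercRepro2
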